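import Literature.NumberTheory.EllipticCurves.MazurTorsionReductionFiveLeavesProofs
import Literature.NumberTheory.EllipticCurves.KubertSixteenProofs
import HarnessLib

/-!
# Mazur's "First reduction" from four leaves: `18, 25, 35, 49`

Topic `NumberTheory/EllipticCurves`; a PROOFS file (theorems only, no `def`, no named fact)
continuing `MazurTorsionReductionFiveLeavesProofs` (`Mazur1977_reduction_to_primes_of_five_leaves`:
the named fact `Mazur1977_reduction_to_primes` of file `MazurTorsion` — Mazur 1977, Ch. III §5,
"First reduction", p. 156, after Kubert 1976 — follows from the five leaves "no rational point of
order `n`", `n ∈ {16, 18, 25, 35, 49}`). The leaf `n = 16` is now the tree's theorem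
`not_exists_addOrderOf_eq_sixteen` (file `KubertSixteenProofs`: `X₁(16)(ℚ)` is cuspidal, by a
two-cover descent of `y² = x(x² + 1)(x² + 2x - 1)` onto the curves `64A`, `32A`), so the fact is
CLOSED MODULO the four statements for `n ∈ {18, 25, 35, 49}` (Kubert 1976 Ch. IV: `X₁(18)`;
Kubert / Kenku / Ligozat: `X₁(25)`, `X₀(35)`, `X₀(49)`). HONEST FRAMING: Mazur's theorem is not
proved here; four leaves stay open.

## References

* [Mazur1977] B. Mazur, *Modular curves and the Eisenstein ideal*, Publ. Math. IHÉS 47 (1977),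
  Ch. III §5 p. 156 (First reduction); Thm. (7'), (8) p. 35.
* [Kubert1976] D. S. Kubert, *Universal bounds on the torsion of elliptic curves*, Proc. London
  Math. Soc. (3) 33 (1976) 193–237, Ch. IV.
-/

noncomputable section

open scoped Classical

open WeierstrassCurve

namespace Literature.NumberTheory.EllipticCurves

/-- **Mazur's First reduction from four leaves.** If no elliptic curve over `ℚ` has a rational
point of order `n` for `n ∈ {18, 25, 35, 49}`, then Mazur's torsion theorem for composite orders
follows from the prime case (`Mazur1977_reduction_to_primes`): the leaf `n = 16` of
`Mazur1977_reduction_to_primes_of_five_leaves` is discharged by the tree's theorem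
`not_exists_addOrderOf_eq_sixteen` (Kubert 1976, `X₁(16)`).
[cite: Mazur1977, Ch. III §5 p. 156 (First reduction, after Kubert); Kubert1976, Ch. IV] -/
theorem Mazur1977_reduction_to_primes_of_four_leaves
    (h : ∀ (V : WeierstrassCurve ℚ) [V.IsElliptic] (n : ℕ),
      n ∈ ({18, 25, 35, 49} : Finset ℕ) → ¬ ∃ P : V.toAffine.Point, addOrderOf P = n) :
    Mazur1977_reduction_to_primes :=
  Mazur1977_reduction_to_primes_of_five_leaves fun V _ n hn ↦ by
    have key : ∀ m ∈ ({16, 18, 25, 35, 49} : Finset ℕ),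
        m = 16 ∨ m ∈ ({18, 25, 35, 49} : Finset ℕ) := by decide
    rcases key n hn with rfl | hn4
    · exact not_exists_addOrderOf_eq_sixteen V
    · exact h V n hn4

end Literature.NumberTheory.EllipticCurves

end
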